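import Mathlib.Tactic.Group
import Summits.MatrixMultiplication.MatrixMultiplication.Theses.GelfandPairHosts
import Summits.MatrixMultiplication.MatrixMultiplication.Theorems.GelfandPairHostsKillGlue
import Summits.MatrixMultiplication.MatrixMultiplication.Theorems.GelfandHosting.Negative.AbelianIndex

/-!
# `GelfandHosting` (crux stmt-MatrixMultiplication-7381), line `birth`/`registered`, stub
# `stub_saturatedTripleHosts`: the block–coset capacity theorem

Negative-side support file of the line lead (continuation c1, 2026-08-17); `sorry`-free, no new
definitions.  The theorem and its proof are ADAPTED FROM the crux-strategist's kernel-checked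
companion `Cruxes/GelfandHosting/StrategistSketch.lean` (§N1, `capacity_block`,
`capacity_le_of_blockStructure`, `capacity_le_card_mul_blocks_sq`; planner seat
`planner-cstrat-stmt-MatrixMultiplication-7381-h1-0`, 2026-08-17), which is a workfile and not
importable; landing it here makes the sharpest general obstruction available to the disprover and to
later seats, and restates it in the vocabulary of the registered stub.

Notation: a group `G` acts on a finite set `X` (`N = |X|`); `β : X → W` is a `G`-invariant block map
(`β x = β y ⇒ β (g • x) = β (g • y)`); a QUOTIENT-FORM design is `(F, Hs ⊆ G, P ⊆ X)` with
`(f'⁻¹ f h⁻¹ h') • p = p' ⇒ f = f' ∧ h = h' ∧ p = p'`; by `quotientDesign_of_saturatedTriple`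
(landed, `Negative/AbelianIndex.lean`) a TPP triple `(S,T,U)` of `G` whose third leg is saturated by
the stabiliser of `x₀` — the data of `stub_saturatedTripleHosts` — gives the quotient-form design
`(S⁻¹, T⁻¹, U • x₀)`.

* §1 `blockCoset_capacity_block` — one block `B = β⁻¹(β p₀)`: if `A ≤ G` fixes `B`, acts on it
  commutatively, and `≤ |T|` cosets `T·A` cover the setwise stabiliser of `B`, then
  `|F|·|Hs|·|P ∩ B| ≤ (|W|·|T|)²·|B|` (injection `(f,h,p) ↦ (block of f•p₀, block of h•p₀,
  coset reps, ((e₂ h)⁻¹ e₂ f) • p)` after two normalisations).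
* §1 `blockCoset_quotientDesign_capacity` — summing over blocks: block–coset data of size `(|W|, ι)`
  at every base point give `|F|·|Hs|·|P| ≤ N·(|W|·ι)²`.  `W = Unit` is the abelian-INDEX bound
  `N·[G:A]²` (`quotientDesign_capacity_le_index_sq`, AffineCapacity without regularity); `ι = 1` is
  §2.
* §2 `blockCoset_quotientDesign_capacity_blocks` — if the setwise stabiliser of every block acts on its
  block commutatively then `|F|·|Hs|·|P| ≤ N·|W|²` (no abelian subgroup of small index needed:
  parabolic hosts `(F₂ᵘ ⊕ F₂ʷ) ⋊ [[I,*],[0,GL_w]]`, `|W| = 2ʷ = D/N`, least abelian index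
  `2^{Θ(w²)}`).
* §3 the same two bounds for stabiliser-saturated TPP triples (`blockCoset_saturatedTriple_capacity`,
  `blockCoset_saturatedTriple_capacity_blocks`).
* §4 `blockCoset_saturatedTriple_witness` — a witness of the `∃`-body of `stub_saturatedTripleHosts`
  at exponent `ε` (transitivity suffices) with block–coset data `(|W|, ι)` satisfies
  `N³ ≤ (N·(|W|ι)²)^{2+ε}`, i.e. `θ := |W|·ι ≥ N^{(1-ε)/(4+2ε)}`: witnesses live only on hosts with
  NO block–coset structure of size `N^{1/4-O(ε)}` — this is the quantity `θ(G,X)` of the census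
  (STRATEGY-CENSUS.md §N-b), equal to `D/N` or less in every host family examined so far
  (abelian-regular 1, dihedral/transvection 2, `A ≀ S_q` q, parabolic `2ʷ`, USP `|U|!`), along which
  the exponent 2 of the theorem is attained (CKSU 2005 wreath triples: `abc/N → 4 = θ²`).

These lemmas do not decide the stub or the crux; the missing piece is a structure theorem
(`ThetaStructure`: near-linear cost `D ≤ N^{1+γ}` ⇒ block–coset data of size `(D/N)^{O(1)}`).
-/

-- the tree's namespace `Summit.MatrixMultiplication.MatrixMultiplication.…` repeats a component by design
set_option linter.dupNamespace false

namespace Summit.MatrixMultiplication.MatrixMultiplication.Theorems.GelfandHosting.Negative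

open Summit.MatrixMultiplication.MatrixMultiplication.Theorems (killGlue_card_le_finrank)

section Capacity

variable {G : Type*} [Group G] {X : Type*} [Fintype X] [DecidableEq X] [MulAction G X]
variable {W : Type*} [Fintype W] [DecidableEq W]

/-! ## §1 The block–coset capacity theorem (quotient-form designs) -/

/-- **Block–coset capacity, one block.**  `β : X → W` is a `G`-invariant block map; `p₀` a point;
`A ≤ G` a subgroup fixing the block `B = β⁻¹(β p₀)` and acting on it commutatively; `T` a finite set
of representatives such that every `g` stabilising `B` lies in `T·A`.  Then every quotient-form design
`(F, Hs, P)` has `|F|·|Hs|·|P ∩ B| ≤ (|W|·|T|)²·|B|`.  Injection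
`(f, h, p) ↦ (block of f•p₀, block of h•p₀, rep of e f, rep of e h, ((e₂ h)⁻¹ e₂ f) • p)`.
Adapted from `Cruxes/GelfandHosting/StrategistSketch.lean` (`capacity_block`). [folklore] -/
theorem blockCoset_capacity_block (β : X → W)
    (hβ : ∀ (g : G) (x y : X), β x = β y → β (g • x) = β (g • y))
    (p₀ : X) (A : Subgroup G) (T : Finset G)
    (hT : ∀ g : G, β (g • p₀) = β p₀ → ∃ t ∈ T, t⁻¹ * g ∈ A)
    (hA : ∀ a ∈ A, β (a • p₀) = β p₀)
    (hcomm : ∀ a ∈ A, ∀ a' ∈ A, ∀ x : X, β x = β p₀ → a • a' • x = a' • a • x)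
    (F Hs : Finset G) (P : Finset X)
    (hdes : ∀ f ∈ F, ∀ f' ∈ F, ∀ h ∈ Hs, ∀ h' ∈ Hs, ∀ p ∈ P, ∀ p' ∈ P,
      (f'⁻¹ * f * h⁻¹ * h') • p = p' → f = f' ∧ h = h' ∧ p = p') :
    F.card * Hs.card * (P.filter fun p => β p = β p₀).card
      ≤ (Fintype.card W * T.card) ^ 2 * (Finset.univ.filter fun x : X => β x = β p₀).card := by
  classical
  -- a section over the blocks reachable from `p₀`
  let s : W → G := fun w => if h : ∃ g : G, β (g • p₀) = w then h.choose else 1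
  have hs : ∀ g : G, β (s (β (g • p₀)) • p₀) = β (g • p₀) := by
    intro g
    have h : ∃ g' : G, β (g' • p₀) = β (g • p₀) := ⟨g, rfl⟩
    show β ((if h : ∃ g' : G, β (g' • p₀) = β (g • p₀) then h.choose else 1) • p₀) = β (g • p₀)
    rw [dif_pos h]
    exact h.choose_spec
  -- first normalisation: `e g` stabilises the block of `p₀`
  let e : G → G := fun g => (s (β (g • p₀)))⁻¹ * g
  have he : ∀ g : G, β (e g • p₀) = β p₀ := by
    intro g
    have h1 := hβ (s (β (g • p₀)))⁻¹ (g • p₀) (s (β (g • p₀)) • p₀) (hs g).symm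
    rw [inv_smul_smul] at h1
    simpa [e, mul_smul] using h1
  have hee : ∀ g g' : G, β (g • p₀) = β (g' • p₀) → (e g')⁻¹ * e g = g'⁻¹ * g := by
    intro g g' hgg
    simp only [e, hgg, mul_inv_rev, inv_inv]
    group
  -- second normalisation: coset representative in `T`
  have hrep : ∀ g : G, ∃ t : G, (β (g • p₀) = β p₀ → t ∈ T ∧ t⁻¹ * g ∈ A) := by
    intro g
    by_cases hg : β (g • p₀) = β p₀
    · obtain ⟨t, ht, hta⟩ := hT g hg
      exact ⟨t, fun _ => ⟨ht, hta⟩⟩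
    · exact ⟨1, fun h => absurd h hg⟩
  choose ρ hρ using hrep
  let e₂ : G → G := fun g => (ρ (e g))⁻¹ * e g
  have hρT : ∀ g : G, ρ (e g) ∈ T := fun g => (hρ (e g) (he g)).1
  have he₂A : ∀ g : G, e₂ g ∈ A := fun g => (hρ (e g) (he g)).2
  have he₂e : ∀ g g' : G, β (g • p₀) = β (g' • p₀) → ρ (e g) = ρ (e g') →
      (e₂ g')⁻¹ * e₂ g = g'⁻¹ * g := by
    intro g g' hgg hρρ
    rw [← hee g g' hgg]
    simp only [e₂, hρρ, mul_inv_rev, inv_inv]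
    group
  -- points of the block stay in the block under `A`
  have hblkA : ∀ a ∈ A, ∀ x : X, β x = β p₀ → β (a • x) = β p₀ := by
    intro a ha x hx
    rw [hβ a x p₀ hx, hA a ha]
  -- the injection
  let Φ : G × G × X → W × W × G × G × X := fun t =>
    (β (t.1 • p₀), β (t.2.1 • p₀), ρ (e t.1), ρ (e t.2.1), ((e₂ t.2.1)⁻¹ * e₂ t.1) • t.2.2)
  set PB := P.filter fun p => β p = β p₀ with hPB
  set B := Finset.univ.filter fun x : X => β x = β p₀ with hB
  have hinj : Set.InjOn Φ ↑(F ×ˢ (Hs ×ˢ PB)) := by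
    rintro ⟨f, h, p⟩ hm ⟨f', h', p'⟩ hm' heq
    simp only [Finset.coe_product, Set.mem_prod, Finset.mem_coe, hPB, Finset.mem_filter] at hm hm'
    obtain ⟨hf, hh, hp, hpB⟩ := hm
    obtain ⟨hf', hh', hp', -⟩ := hm'
    simp only [Φ, Prod.mk.injEq] at heq
    obtain ⟨e1, e2, e3, e4, e5⟩ := heq
    have u2 : e₂ h' ∈ A := he₂A h'
    have u3 : (e₂ h)⁻¹ ∈ A := A.inv_mem (he₂A h)
    have u4 : e₂ f ∈ A := he₂A f
    -- from `e5`: `p' = ((e₂ f')⁻¹ * e₂ h' * (e₂ h)⁻¹ * e₂ f) • p`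
    have h5 : ((e₂ f')⁻¹ * (e₂ h' * ((e₂ h)⁻¹ * e₂ f))) • p = p' := by
      have h5a : ((e₂ h')⁻¹ * e₂ f')⁻¹ • (((e₂ h)⁻¹ * e₂ f) • p) = p' := by
        rw [e5, inv_smul_smul]
      rw [← h5a, ← mul_smul]
      congr 1
      group
    -- commute the middle: `u₂ (u₃ (u₄ p)) = u₄ (u₃ (u₂ p))` inside the block
    have hmid : (e₂ h' * ((e₂ h)⁻¹ * e₂ f)) • p = (e₂ f * ((e₂ h)⁻¹ * e₂ h')) • p := by
      have s1 : e₂ h' • (e₂ h)⁻¹ • (e₂ f • p) = (e₂ h)⁻¹ • e₂ h' • (e₂ f • p) :=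
        hcomm _ u2 _ u3 _ (hblkA _ u4 _ hpB)
      have s2 : e₂ h' • (e₂ f • p) = e₂ f • (e₂ h' • p) := hcomm _ u2 _ u4 _ hpB
      have s3 : (e₂ h)⁻¹ • e₂ f • (e₂ h' • p) = e₂ f • (e₂ h)⁻¹ • (e₂ h' • p) :=
        hcomm _ u3 _ u4 _ (hblkA _ u2 _ hpB)
      simp only [mul_smul]
      rw [s1, s2, s3]
    have h6 : ((e₂ f')⁻¹ * (e₂ f * ((e₂ h)⁻¹ * e₂ h'))) • p = p' := by
      rw [mul_smul, ← hmid, ← mul_smul, h5]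
    have h6' : ((e₂ f')⁻¹ * e₂ f * ((e₂ h)⁻¹ * e₂ h')) • p = p' := by
      rw [← h6]; congr 1; group
    rw [he₂e f f' e1 e3, he₂e h' h e2.symm e4.symm] at h6'
    have h7 : (f'⁻¹ * f * h⁻¹ * h') • p = p' := by
      rw [← h6']; congr 1; group
    obtain ⟨r1, r2, r3⟩ := hdes f hf f' hf' h hh h' hh' p hp p' hp' h7
    subst r1 r2 r3
    rfl
  -- the image lies in `W × W × T × T × B`
  have himg : (F ×ˢ (Hs ×ˢ PB)).image Φ ⊆
      Finset.univ ×ˢ (Finset.univ ×ˢ (T ×ˢ (T ×ˢ B))) := by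
    intro v hv
    rw [Finset.mem_image] at hv
    obtain ⟨⟨f, h, p⟩, hm, rfl⟩ := hv
    simp only [Finset.mem_product, hPB, Finset.mem_filter] at hm
    obtain ⟨-, -, -, hpB⟩ := hm
    simp only [Φ, Finset.mem_product, Finset.mem_univ, true_and, hB, Finset.mem_filter]
    refine ⟨hρT f, hρT h, ?_⟩
    rw [mul_smul]
    exact hblkA _ (A.inv_mem (he₂A h)) _ (hblkA _ (he₂A f) _ hpB)
  calc F.card * Hs.card * PB.card
      = (F ×ˢ (Hs ×ˢ PB)).card := by rw [Finset.card_product, Finset.card_product, mul_assoc]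
    _ = ((F ×ˢ (Hs ×ˢ PB)).image Φ).card := (Finset.card_image_of_injOn hinj).symm
    _ ≤ (Finset.univ ×ˢ (Finset.univ ×ˢ (T ×ˢ (T ×ˢ B))) : Finset (W × W × G × G × X)).card :=
        Finset.card_le_card himg
    _ = (Fintype.card W * T.card) ^ 2 * B.card := by
        simp only [Finset.card_product, Finset.card_univ]; ring

/-- **Block–coset capacity theorem.**  If every block `B = β⁻¹(w)` of a `G`-invariant block map
`β : X → W` carries a subgroup `A_B ≤ G` fixing `B`, acting on it commutatively, and of index `≤ ι`
in the setwise stabiliser of `B` (witnessed by `≤ ι` coset representatives), then every quotient-form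
design has `|F|·|Hs|·|P| ≤ |X|·(|W|·ι)²`.  `W = Unit`: the abelian-index bound `N·[G:A]²`
(`quotientDesign_capacity_le_index_sq`); `ι = 1`: the abelian-block bound `N·|W|²` (§2).
Adapted from `Cruxes/GelfandHosting/StrategistSketch.lean` (`capacity_le_of_blockStructure`). [folklore] -/
theorem blockCoset_quotientDesign_capacity (β : X → W)
    (hβ : ∀ (g : G) (x y : X), β x = β y → β (g • x) = β (g • y)) (ι : ℕ)
    (hstr : ∀ p₀ : X, ∃ (A : Subgroup G) (T : Finset G), T.card ≤ ι ∧
      (∀ g : G, β (g • p₀) = β p₀ → ∃ t ∈ T, t⁻¹ * g ∈ A) ∧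
      (∀ a ∈ A, β (a • p₀) = β p₀) ∧
      (∀ a ∈ A, ∀ a' ∈ A, ∀ x : X, β x = β p₀ → a • a' • x = a' • a • x))
    (F Hs : Finset G) (P : Finset X)
    (hdes : ∀ f ∈ F, ∀ f' ∈ F, ∀ h ∈ Hs, ∀ h' ∈ Hs, ∀ p ∈ P, ∀ p' ∈ P,
      (f'⁻¹ * f * h⁻¹ * h') • p = p' → f = f' ∧ h = h' ∧ p = p') :
    F.card * Hs.card * P.card ≤ Fintype.card X * (Fintype.card W * ι) ^ 2 := by
  classical
  have hP : P.card = ∑ w : W, (P.filter fun p => β p = w).card :=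
    Finset.card_eq_sum_card_fiberwise (f := β) (fun x _ => by simp)
  have hX : Fintype.card X = ∑ w : W, (Finset.univ.filter fun x : X => β x = w).card := by
    rw [← Finset.card_univ]
    exact Finset.card_eq_sum_card_fiberwise (f := β) (fun x _ => by simp)
  have key : ∀ w : W, F.card * Hs.card * (P.filter fun p => β p = w).card
      ≤ (Fintype.card W * ι) ^ 2 * (Finset.univ.filter fun x : X => β x = w).card := by
    intro w
    by_cases hw : ∃ x : X, β x = w
    · obtain ⟨x₀, rfl⟩ := hw
      obtain ⟨A, T, hTι, hT, hA, hcomm⟩ := hstr x₀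
      calc F.card * Hs.card * (P.filter fun p => β p = β x₀).card
          ≤ (Fintype.card W * T.card) ^ 2 * (Finset.univ.filter fun x : X => β x = β x₀).card :=
            blockCoset_capacity_block β hβ x₀ A T hT hA hcomm F Hs P hdes
        _ ≤ (Fintype.card W * ι) ^ 2 * (Finset.univ.filter fun x : X => β x = β x₀).card := by
            gcongr
    · have h0 : (P.filter fun p => β p = w) = ∅ :=
        Finset.filter_eq_empty_iff.mpr fun p _ hp => hw ⟨p, hp⟩
      simp [h0]
  calc F.card * Hs.card * P.card
      = ∑ w : W, F.card * Hs.card * (P.filter fun p => β p = w).card := by rw [hP, Finset.mul_sum]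
    _ ≤ ∑ w : W, (Fintype.card W * ι) ^ 2 * (Finset.univ.filter fun x : X => β x = w).card :=
        Finset.sum_le_sum fun w _ => key w
    _ = (Fintype.card W * ι) ^ 2 * ∑ w : W, (Finset.univ.filter fun x : X => β x = w).card := by
        rw [Finset.mul_sum]
    _ = Fintype.card X * (Fintype.card W * ι) ^ 2 := by rw [← hX]; ring

/-! ## §2 Abelian block actions (`ι = 1`) -/

/-- **Abelian-block capacity**: if the setwise stabiliser of every block of a `G`-invariant block map
`β : X → W` acts on its block commutatively, every quotient-form design has
`|F|·|Hs|·|P| ≤ |X|·|W|²` — no abelian subgroup of small index is needed (parabolic hosts: the least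
index of an abelian subgroup is superpolynomial in `|X|` while `|W| = D/N`).  The block–coset data are
`A =` the setwise stabiliser of the block of `p₀` (built inside the proof) and `T = {1}`.
Adapted from `Cruxes/GelfandHosting/StrategistSketch.lean` (`capacity_le_card_mul_blocks_sq`). [folklore] -/
theorem blockCoset_quotientDesign_capacity_blocks (β : X → W)
    (hβ : ∀ (g : G) (x y : X), β x = β y → β (g • x) = β (g • y))
    (hab : ∀ (g g' : G) (x : X), β (g • x) = β x → β (g' • x) = β x → g • g' • x = g' • g • x)
    (F Hs : Finset G) (P : Finset X)
    (hdes : ∀ f ∈ F, ∀ f' ∈ F, ∀ h ∈ Hs, ∀ h' ∈ Hs, ∀ p ∈ P, ∀ p' ∈ P,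
      (f'⁻¹ * f * h⁻¹ * h') • p = p' → f = f' ∧ h = h' ∧ p = p') :
    F.card * Hs.card * P.card ≤ Fintype.card X * Fintype.card W ^ 2 := by
  classical
  -- the setwise stabiliser of the block of `p₀`, as a subgroup
  have hmul : ∀ (p₀ : X) (a b : G), β (a • p₀) = β p₀ → β (b • p₀) = β p₀ →
      β ((a * b) • p₀) = β p₀ := by
    intro p₀ a b ha hb
    rw [mul_smul, hβ a (b • p₀) p₀ hb, ha]
  have hinv : ∀ (p₀ : X) (a : G), β (a • p₀) = β p₀ → β (a⁻¹ • p₀) = β p₀ := by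
    intro p₀ a ha
    have := hβ a⁻¹ (a • p₀) p₀ ha
    rw [inv_smul_smul] at this
    exact this.symm
  have h := blockCoset_quotientDesign_capacity β hβ 1 (fun p₀ =>
    ⟨{ carrier := {g | β (g • p₀) = β p₀}
       one_mem' := by simp
       mul_mem' := fun {a} {b} ha hb => hmul p₀ a b ha hb
       inv_mem' := fun {a} ha => hinv p₀ a ha }, {1}, by simp,
      fun g hg => ⟨1, Finset.mem_singleton_self _, by simpa using hg⟩,
      fun a ha => ha, fun a ha a' ha' x hx => ?_⟩) F Hs P hdes
  · simpa using h
  · have ha0 : β (a • p₀) = β p₀ := ha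
    have ha0' : β (a' • p₀) = β p₀ := ha'
    have hax : β (a • x) = β x := by rw [hβ a x p₀ hx, ha0, hx]
    have ha'x : β (a' • x) = β x := by rw [hβ a' x p₀ hx, ha0', hx]
    exact hab a a' x hax ha'x

end Capacity

/-! ## §3 The same bounds for stabiliser-saturated TPP triples (vocabulary of `stub_saturatedTripleHosts`)

(`G`, `X`, `W` in `Type`, matching the registered stub and `quotientDesign_of_saturatedTriple`.) -/

section Saturated

variable {G : Type} [Group G] {X : Type} [Fintype X] [DecidableEq X] [MulAction G X]
variable {W : Type} [Fintype W] [DecidableEq W]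

/-- **Block–coset capacity for saturated TPP triples.** In the setting of `stub_saturatedTripleHosts`
(a TPP triple `(S,T,U)` of `G`, Cohn–Umans 2003 Def. 2.1 form, with `U · G_{x₀} = U`), block–coset
data of size `(|W|, ι)` at every base point give `|S|·|T|·|U • x₀| ≤ |X|·(|W|·ι)²`. [folklore] -/
theorem blockCoset_saturatedTriple_capacity (β : X → W)
    (hβ : ∀ (g : G) (x y : X), β x = β y → β (g • x) = β (g • y)) (ι : ℕ)
    (hstr : ∀ p₀ : X, ∃ (A : Subgroup G) (T : Finset G), T.card ≤ ι ∧
      (∀ g : G, β (g • p₀) = β p₀ → ∃ t ∈ T, t⁻¹ * g ∈ A) ∧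
      (∀ a ∈ A, β (a • p₀) = β p₀) ∧
      (∀ a ∈ A, ∀ a' ∈ A, ∀ x : X, β x = β p₀ → a • a' • x = a' • a • x))
    (x₀ : X) (S T U : Finset G)
    (htpp : ∀ s ∈ S, ∀ s' ∈ S, ∀ t ∈ T, ∀ t' ∈ T, ∀ u ∈ U, ∀ u' ∈ U,
      s * s'⁻¹ * (t * t'⁻¹) * (u * u'⁻¹) = 1 → s = s' ∧ t = t' ∧ u = u')
    (hsat : ∀ u ∈ U, ∀ h : G, h • x₀ = x₀ → u * h ∈ U) :
    S.card * T.card * (U.image fun u => u • x₀).card ≤ Fintype.card X * (Fintype.card W * ι) ^ 2 := by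
  classical
  have h := blockCoset_quotientDesign_capacity β hβ ι hstr (S.image (·⁻¹)) (T.image (·⁻¹))
    (U.image (· • x₀)) (quotientDesign_of_saturatedTriple x₀ S T U htpp hsat)
  rwa [Finset.card_image_of_injective _ inv_injective,
    Finset.card_image_of_injective _ inv_injective] at h

/-- **Abelian-block capacity for saturated TPP triples**: if the setwise stabiliser of every block
acts on its block commutatively, `|S|·|T|·|U • x₀| ≤ |X|·|W|²`. [folklore] -/
theorem blockCoset_saturatedTriple_capacity_blocks (β : X → W)
    (hβ : ∀ (g : G) (x y : X), β x = β y → β (g • x) = β (g • y))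
    (hab : ∀ (g g' : G) (x : X), β (g • x) = β x → β (g' • x) = β x → g • g' • x = g' • g • x)
    (x₀ : X) (S T U : Finset G)
    (htpp : ∀ s ∈ S, ∀ s' ∈ S, ∀ t ∈ T, ∀ t' ∈ T, ∀ u ∈ U, ∀ u' ∈ U,
      s * s'⁻¹ * (t * t'⁻¹) * (u * u'⁻¹) = 1 → s = s' ∧ t = t' ∧ u = u')
    (hsat : ∀ u ∈ U, ∀ h : G, h • x₀ = x₀ → u * h ∈ U) :
    S.card * T.card * (U.image fun u => u • x₀).card ≤ Fintype.card X * Fintype.card W ^ 2 := by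
  classical
  have h := blockCoset_quotientDesign_capacity_blocks β hβ hab (S.image (·⁻¹)) (T.image (·⁻¹))
    (U.image (· • x₀)) (quotientDesign_of_saturatedTriple x₀ S T U htpp hsat)
  rwa [Finset.card_image_of_injective _ inv_injective,
    Finset.card_image_of_injective _ inv_injective] at h

end Saturated

/-! ## §4 Consequence for witnesses of `stub_saturatedTripleHosts` -/

/-- **Witnesses of the stub have no small block–coset structure.** Let the finite group `G` act
transitively on `X` (`N = |X|`) with a TPP triple `(S,T,U)`, `U · G_{x₀} = U`, and host cost
`D = dim span{P_g} ≤ (|S||T||U•x₀|)^{(2+ε)/3}` — the `∃`-body of `stub_saturatedTripleHosts` at `ε`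
with generous transitivity weakened to transitivity.  If `G ↷ X` admits block–coset data of size
`(|W|, ι)` (a `G`-invariant block map `β : X → W` and, at every base point, a subgroup fixing the block,
acting on it commutatively, of index `≤ ι` in the block stabiliser), then `N³ ≤ (N·(|W|ι)²)^{2+ε}`,
i.e. `θ = |W|·ι ≥ N^{(1-ε)/(4+2ε)}`: `N ≤ D` (`killGlue_card_le_finrank`) and §3. [folklore] -/
theorem blockCoset_saturatedTriple_witness {G : Type} [Group G] [Fintype G]
    {X : Type} [Fintype X] [DecidableEq X] [MulAction G X] {W : Type} [Fintype W] [DecidableEq W]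
    (β : X → W) (hβ : ∀ (g : G) (x y : X), β x = β y → β (g • x) = β (g • y)) (ι : ℕ)
    (hstr : ∀ p₀ : X, ∃ (A : Subgroup G) (T : Finset G), T.card ≤ ι ∧
      (∀ g : G, β (g • p₀) = β p₀ → ∃ t ∈ T, t⁻¹ * g ∈ A) ∧
      (∀ a ∈ A, β (a • p₀) = β p₀) ∧
      (∀ a ∈ A, ∀ a' ∈ A, ∀ x : X, β x = β p₀ → a • a' • x = a' • a • x))
    (x₀ : X) (S T U : Finset G) (ε : ℝ) (hε : 0 < ε)
    (htrans : ∀ x y : X, ∃ g : G, g • x = y)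
    (htpp : ∀ s ∈ S, ∀ s' ∈ S, ∀ t ∈ T, ∀ t' ∈ T, ∀ u ∈ U, ∀ u' ∈ U,
      s * s'⁻¹ * (t * t'⁻¹) * (u * u'⁻¹) = 1 → s = s' ∧ t = t' ∧ u = u')
    (hsat : ∀ u ∈ U, ∀ h : G, h • x₀ = x₀ → u * h ∈ U)
    (hD : (Module.finrank ℂ (Submodule.span ℂ (Set.range fun g : G =>
        Matrix.of fun y x : X => if g • x = y then (1 : ℂ) else 0)) : ℝ) ≤
      ((S.card * T.card * (U.image fun u => u • x₀).card : ℕ) : ℝ) ^ ((2 + ε) / 3)) :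
    (Fintype.card X : ℝ) ^ (3 : ℝ) ≤
      ((Fintype.card X * (Fintype.card W * ι) ^ 2 : ℕ) : ℝ) ^ (2 + ε) := by
  have hN : (Fintype.card X : ℝ) ≤ (Module.finrank ℂ (Submodule.span ℂ (Set.range fun g : G =>
      Matrix.of fun y x : X => if g • x = y then (1 : ℂ) else 0)) : ℝ) := by
    exact_mod_cast killGlue_card_le_finrank x₀ htrans
  have hcap : ((S.card * T.card * (U.image fun u => u • x₀).card : ℕ) : ℝ) ≤
      ((Fintype.card X * (Fintype.card W * ι) ^ 2 : ℕ) : ℝ) := by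
    exact_mod_cast blockCoset_saturatedTriple_capacity β hβ ι hstr x₀ S T U htpp hsat
  have hexp : 0 ≤ (2 + ε) / 3 := by positivity
  have h1 : (Fintype.card X : ℝ) ≤
      ((Fintype.card X * (Fintype.card W * ι) ^ 2 : ℕ) : ℝ) ^ ((2 + ε) / 3) :=
    hN.trans (hD.trans (Real.rpow_le_rpow (by positivity) hcap hexp))
  have h2 := Real.rpow_le_rpow (by positivity) h1 (show (0 : ℝ) ≤ 3 by norm_num)
  rw [← Real.rpow_mul (by positivity)] at h2
  have e : (2 + ε) / 3 * 3 = 2 + ε := by ring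
  rwa [e] at h2

end Summit.MatrixMultiplication.MatrixMultiplication.Theorems.GelfandHosting.Negative
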